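import Summits.ABC.ABC.Theorems.IsogenyGlueCongruenceEllipticGluingPrimeBoundFreeOfBound
import HarnessLib

/-!
# Crux U `EllipticGluingPrimeBound` (stmt-ABC-13919): the converse for the sharpened residual

Skeleton v11 of line `Sketch` sharpens the residual stub to `U_simple`
(`stub_simpleFreeTorsionBound`): the height-free torsion-sharing bound for **ℚ-simple**
geometrically `E`-free partners `A` at primes `ℓ` where `W[ℓ]` is irreducible.  Since `U_simple`
is `U_free` with two extra hypotheses, the landed converse
`geomFreeTorsionBound_of_ellipticGluingPrimeBound : EllipticGluingPrimeBound → U_free`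
(…EllipticGluingPrimeBoundFreeOfBound.lean, p117323) gives at once

* `simpleFreeTorsionBound_of_ellipticGluingPrimeBound : EllipticGluingPrimeBound → U_simple`
  (same `κ`, same `C`).

With the skeleton's proved direction (`stub_freeOfSimple`, `bound_of_branches₃`) this makes
`U_simple` EQUIVALENT to the crux modulo the named inputs (Masser–Wüstholz, CM torsion image,
`FaltingsTate`). Unconditional; lands `--supports stmt-ABC-13919`.
-/

noncomputable section

-- `Summit.<Summit>.<Problem>` is the mandated summit-side namespace (CONVENTIONS §2); for the
-- single-conjunct summit `ABC` the two coincide, so the duplicate `ABC.ABC` is deliberate.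
set_option linter.dupNamespace false

namespace Summit.ABC.ABC.Theorems.IsotypicMinkowski

open CategoryTheory CategoryTheory.Limits AlgebraicGeometry
open Literature.AlgebraicGeometry.Motives
open Summit.ABC.ABC.Theses.IsogenyGlueCongruence

/-- **`U → U_simple`**: the crux implies the sharpened residual stub of skeleton v11 (torsion
sharing with ℚ-simple geometrically `E`-free partners at primes of irreducible `W[ℓ]`), with the
same exponent and constant — immediate from `geomFreeTorsionBound_of_ellipticGluingPrimeBound`
by discarding the simplicity and irreducibility hypotheses. -/
theorem simpleFreeTorsionBound_of_ellipticGluingPrimeBound (hU : EllipticGluingPrimeBound) :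
    ∃ κ C : ℝ, 0 ≤ κ ∧ ∀ (W : WeierstrassCurve ℚ) [W.IsElliptic] (E A : AbelianVariety.{0} ℚ)
      (e : E.geomPoints ≃+ W.geomPoints),
      (∀ (σ : Field.absoluteGaloisGroup ℚ) (P : E.geomPoints), e (σ • P) = σ • e P) →
      (∀ f : E.baseChange (AlgebraicClosure ℚ) ⟶ A.baseChange (AlgebraicClosure ℚ), f = 0) →
      AbelianVariety.IsSimple A →
      ∀ ℓ : ℕ, ℓ.Prime → W.HasIrreducibleModPGaloisRep ℓ →
      (∃ ι : W.geomTorsion ℓ →+ A.geomPoints, Function.Injective ι ∧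
        ∀ (σ : Field.absoluteGaloisGroup ℚ) (P : W.geomTorsion ℓ), ι (σ • P) = σ • ι P) →
        (ℓ : ℝ) ≤ C * (((A.dim : ℝ) + 1) * max 1 W.stableFaltingsHeight) ^ κ := by
  obtain ⟨κ, C, hκ, h⟩ := geomFreeTorsionBound_of_ellipticGluingPrimeBound hU
  exact ⟨κ, C, hκ, fun W _ E A e he hfree _ ℓ hℓ _ hι ↦ h W E A e he hfree ℓ hℓ hι⟩

end Summit.ABC.ABC.Theorems.IsotypicMinkowski

end
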